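import Summits.QuantumFields.YangMills.Theorems.FluctuationComparisonRegPrIntLS2BetaThresholdSum
import HarnessLib

/-!
# GAP♯∘'s KINEMATIC LETTER — ONE-STEP∘ REDUCED TO ITS ROOTED CASE `w̄ ≡ 1` (the setting of [Balaban1985RegularSpaces] Lemma 1: «u = 1 on the coarse lattice»)
# (crux `FluctuationComparisonRegPrIntL`, stmt-QuantumFields-20520; registry v11.4 `Cruxes/FluctuationComparisonRegPrIntL/Lines/semiclassical_s2beta.lean` 3732b7df FROZEN, untouched)

Cell `ym3-torus` (YM ladder rung R3 = continuum `SU(2)` Yang–Mills on the three-torus — a RUNG: NOT d = 4, NOT infinite volume, NOT a mass gap, NOT Clay).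
Seat `ymfull-r3-prover-3` (gen 0; R590-ym (a) item (3)); `--kind proof --supports stmt-QuantumFields-20520 --as helper`, count-neutral, DEFINITION-FREE (0 `def`, 0 `instance`,
0 `notation`, 0 `sorry`, default heartbeats).  Fifth file of the seat; sits on ✓`…S2BetaThresholdSum` (`closePair_of_oneStep`).

WHAT.  The displayed one-step letter ONE-STEP∘ of `…S2BetaClosePairOfOneStep` compares two height-`i` fields whose block averages are `α₁`-close MODULO an arbitrary coarse
transformation `w̄`, and asks for a fine `w` with `w ∘ emb = w̄`.  Print's Lemma 1 ([Balaban1985RegularSpaces] (1.24)–(1.26) pp.79–80) is stated in the gauge «`u = 1` on the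
coarse lattice» — the ROOTED case `w̄ ≡ 1`.  The general case follows by covariance of the (0.4) averaging under the block-constant lift of `w̄`
(✓`B12RTGaugeInvariance254.avg_gaugeAct_liftTransf`: `avg((lift w̄)•X) = w̄•avg X`, ✓`liftTransf_emb`: `(lift w̄) ∘ emb = w̄`) and conjugation invariance of the plaquette
variables (✓`T3PrintedRegularOrbits.plaqSmall_gaugeAct_iff'`): apply the rooted letter to `(lift w̄)•X` and `X′`, and compose `w := w₁·(lift w̄)` (✓`gaugeAct_mul_eq`).

* §1 ★★ `oneStep_of_oneStepRooted (hR : ⟨ONE-STEP-ROOTED∘⟩) : ⟨ONE-STEP∘ VERBATIM⟩` — ONE-STEP-ROOTED∘ = ONE-STEP∘ with `w̄` deleted from the hypothesis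
  (`dist1((avg X′) b·((avg X) b)⁻¹) ≤ α₁`) and `w ∘ emb ≡ 1` in the conclusion.
* §2 ★★★ `closePair_of_oneStepRooted (hR) : ⟨CLOSE-PAIR∘ VERBATIM⟩` := `closePair_of_oneStep (oneStep_of_oneStepRooted hR)`.

NET (CREDIT NOTHING): «CLOSE-PAIR∘ modulo ONE-STEP-ROOTED∘» — the letter now has EXACTLY print's shape: two fields of one averaging step with small plaquette variables and `α₁`-close
averages are `(α₁ + C·α₀)`-close modulo a ROOTED fine transformation.  HONEST: a reduction; ONE-STEP-ROOTED∘ (Lemma 1 on one (0.4)-step of the T³ tower: intra-block half =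
✓`Prop7AxialGaugeBlock.dist1_mul_inv_le_interior`, inter-block half open), TUBE-REG∘, GAP♯∘, EXW∘, S2β, crux 20520 are NOT proved here; no summit statement is proved by a helper;
finite-volume ∕ conditional; rung R3 = SU(2) YM₃ on T³ — NOT d = 4, NOT infinite volume, NOT a mass gap, NOT Clay; the Yang–Mills mass gap is NOT proved.  Sorry-free, axioms standard.

References: T. Bałaban, CMP **99** (1985) 75–102 [Balaban1985RegularSpaces] (Lemma 1 (1.24)–(1.26) pp.79–80); CMP **98** (1985) 17–51 [Balaban1985Averaging] ((11)–(13) p.19);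
CMP **102** (1985) 255–275 [Balaban1985UV3] ((12)–(13) p.259).
-/

set_option autoImplicit false

noncomputable section

open MeasureTheory Filter Topology Set
open scoped Matrix.Norms.L2Operator
open Literature.MathematicalPhysics.QuantumFieldTheory.Balaban1983to89
open Literature.MathematicalPhysics.QuantumFieldTheory.Balaban1983to89.T3ContinuumYM3Torus
open Literature.MathematicalPhysics.QuantumFieldTheory.Balaban1983to89.T3UnitLawDensityEML
open Literature.MathematicalPhysics.QuantumFieldTheory.Balaban1983to89.T3UnitScaleTilt
open Literature.MathematicalPhysics.QuantumFieldTheory.Balaban1983to89.T3TiltDescent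
open Literature.MathematicalPhysics.QuantumFieldTheory.Balaban1983to89.T3PrintedRegularMinimiser
open Literature.MathematicalPhysics.QuantumFieldTheory.Balaban1983to89.T3PrintedRegularOrbits
open Literature.MathematicalPhysics.QuantumFieldTheory.Balaban1983to89.T3ConstrainedMinimiser (fibre)
open Literature.MathematicalPhysics.QuantumFieldTheory.Balaban1983to89.Missing
open Literature.MathematicalPhysics.QuantumFieldTheory.Balaban1983to89.T4Continuum
open Summit.QuantumFields.YangMills.Theorems.FluctuationComparisonRegPrIntLS2BetaResidualGauge
open Summit.QuantumFields.YangMills.Theorems.FluctuationComparisonRegPrIntLS2BetaThresholdSum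

namespace Summit.QuantumFields.YangMills.Theorems.FluctuationComparisonRegPrIntLS2BetaOneStepLift

/-! ## §1 ONE-STEP∘ from its rooted case -/

/-- ★★ **ONE-STEP-ROOTED∘ ⟹ ONE-STEP∘**: a coarse transformation `w̄` in the comparison of the averages is absorbed by its block-constant lift — apply the rooted letter to
`(lift w̄)•X` and `X′` (`avg((lift w̄)•X) = w̄•avg X`, plaquette variables are conjugation invariant) and compose `w := w₁·lift w̄`, `w ∘ emb = 1·w̄ = w̄`.
[cite: Balaban1985RegularSpaces, Lemma 1 (1.24)-(1.26) pp.79-80; Balaban1985Averaging, (11)-(13) p.19] -/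
theorem oneStep_of_oneStepRooted
    (hR : ∀ (L : ℕ), ∃ C : ℝ, 0 ≤ C ∧ ∃ a₀ : ℝ, 0 < a₀ ∧ ∀ (F : T3Family), F.L = L → ∀ (K i : ℕ), i < K →
      ∀ (X X' : GaugeField (F.P K) i (Matrix.specialUnitaryGroup (Fin 2) ℂ)) (α₀ α₁ : ℝ), 0 ≤ α₀ → α₀ ≤ a₀ → 0 ≤ α₁ →
        PlaqSmall α₀ X → PlaqSmall α₀ X' →
        (∀ b : PBond (F.P K) (i + 1),
          dist1 (((BlockAveraging.blockAvg (P := F.P K) (j := i) ℰp).avg X') b *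
            (((BlockAveraging.blockAvg (P := F.P K) (j := i) ℰp).avg X) b)⁻¹) ≤ α₁) →
        ∃ w : Site (F.P K) i → Matrix.specialUnitaryGroup (Fin 2) ℂ,
          (fun y => w (emb y)) = (fun _ => 1) ∧ ∀ ℓ : PBond (F.P K) i, dist1 (X' ℓ * ((GaugeField.gaugeAct w X) ℓ)⁻¹) ≤ α₁ + C * α₀) :
    ∀ (L : ℕ), ∃ C : ℝ, 0 ≤ C ∧ ∃ a₀ : ℝ, 0 < a₀ ∧ ∀ (F : T3Family), F.L = L → ∀ (K i : ℕ), i < K →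
      ∀ (X X' : GaugeField (F.P K) i (Matrix.specialUnitaryGroup (Fin 2) ℂ))
        (wbar : Site (F.P K) (i + 1) → Matrix.specialUnitaryGroup (Fin 2) ℂ) (α₀ α₁ : ℝ), 0 ≤ α₀ → α₀ ≤ a₀ → 0 ≤ α₁ →
        PlaqSmall α₀ X → PlaqSmall α₀ X' →
        (∀ b : PBond (F.P K) (i + 1),
          dist1 (((BlockAveraging.blockAvg (P := F.P K) (j := i) ℰp).avg X') b *
            ((GaugeField.gaugeAct wbar ((BlockAveraging.blockAvg (P := F.P K) (j := i) ℰp).avg X)) b)⁻¹) ≤ α₁) →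
        ∃ w : Site (F.P K) i → Matrix.specialUnitaryGroup (Fin 2) ℂ,
          (fun y => w (emb y)) = wbar ∧ ∀ ℓ : PBond (F.P K) i, dist1 (X' ℓ * ((GaugeField.gaugeAct w X) ℓ)⁻¹) ≤ α₁ + C * α₀ := by
  intro L
  obtain ⟨C, hC, a₀, ha₀, H⟩ := hR L
  refine ⟨C, hC, a₀, ha₀, fun F hFL K i hi X X' wbar α₀ α₁ hα₀ hα₀a hα₁ hX hX' havg => ?_⟩
  have hi1 : i + 1 ≤ (F.P K).m + (F.P K).K := by show i + 1 ≤ F.m + K; omega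
  -- the lifted field `(lift w̄)•X`: same plaquette variables, average `w̄•avg X`
  have hX'' : PlaqSmall α₀ (GaugeField.gaugeAct (B12RTGaugeInvariance254.liftTransf wbar) X) :=
    (T3PrintedRegularOrbits.plaqSmall_gaugeAct_iff' α₀ _ X).mpr hX
  have havg'' : (BlockAveraging.blockAvg (P := F.P K) (j := i) ℰp).avg
      (GaugeField.gaugeAct (B12RTGaugeInvariance254.liftTransf wbar) X) =
      GaugeField.gaugeAct wbar ((BlockAveraging.blockAvg (P := F.P K) (j := i) ℰp).avg X) :=
    B12RTGaugeInvariance254.avg_gaugeAct_liftTransf hi1 _ wbar X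
  obtain ⟨w₁, hw₁, hd⟩ := H F hFL K i hi (GaugeField.gaugeAct (B12RTGaugeInvariance254.liftTransf wbar) X) X' α₀ α₁
    hα₀ hα₀a hα₁ hX'' hX' (fun b => by rw [havg'']; exact havg b)
  refine ⟨fun x => w₁ x * B12RTGaugeInvariance254.liftTransf wbar x, ?_, fun ℓ => ?_⟩
  · funext y
    show w₁ (emb y) * B12RTGaugeInvariance254.liftTransf wbar (emb y) = wbar y
    rw [show w₁ (emb y) = 1 from congrFun hw₁ y, one_mul, B12RTGaugeInvariance254.liftTransf_emb hi1]
  · have key : GaugeField.gaugeAct (fun x => w₁ x * B12RTGaugeInvariance254.liftTransf wbar x) X =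
        GaugeField.gaugeAct w₁ (GaugeField.gaugeAct (B12RTGaugeInvariance254.liftTransf wbar) X) :=
      gaugeAct_mul_eq w₁ (fun x => B12RTGaugeInvariance254.liftTransf wbar x) X
    rw [key]
    exact hd ℓ

/-! ## §2 CLOSE-PAIR∘ from the rooted one-step letter -/

/-- ★★★ **ONE-STEP-ROOTED∘ ⟹ CLOSE-PAIR∘** (§1 ∘ ✓`closePair_of_oneStep`): the kinematic letter of GAP♯∘ reduced to [Balaban1985RegularSpaces] Lemma 1 in print's own gauge
«`u = 1` on the coarse lattice», on one (0.4)-averaging step of the T³ tower. [cite: Balaban1985RegularSpaces, Lemma 1 (1.24)-(1.26) pp.79-80; Balaban1985UV3, (12)-(13) p.259] -/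
theorem closePair_of_oneStepRooted
    (hR : ∀ (L : ℕ), ∃ C : ℝ, 0 ≤ C ∧ ∃ a₀ : ℝ, 0 < a₀ ∧ ∀ (F : T3Family), F.L = L → ∀ (K i : ℕ), i < K →
      ∀ (X X' : GaugeField (F.P K) i (Matrix.specialUnitaryGroup (Fin 2) ℂ)) (α₀ α₁ : ℝ), 0 ≤ α₀ → α₀ ≤ a₀ → 0 ≤ α₁ →
        PlaqSmall α₀ X → PlaqSmall α₀ X' →
        (∀ b : PBond (F.P K) (i + 1),
          dist1 (((BlockAveraging.blockAvg (P := F.P K) (j := i) ℰp).avg X') b *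
            (((BlockAveraging.blockAvg (P := F.P K) (j := i) ℰp).avg X) b)⁻¹) ≤ α₁) →
        ∃ w : Site (F.P K) i → Matrix.specialUnitaryGroup (Fin 2) ℂ,
          (fun y => w (emb y)) = (fun _ => 1) ∧ ∀ ℓ : PBond (F.P K) i, dist1 (X' ℓ * ((GaugeField.gaugeAct w X) ℓ)⁻¹) ≤ α₁ + C * α₀) :
    ∀ (L : ℕ) (b₀ p₀ : ℝ), 0 < b₀ → 0 < p₀ → ∀ (δ : ℝ), 0 < δ →
      ∃ γ₁ : ℝ, 0 < γ₁ ∧ ∀ (F : T3Family) (γ : ℝ), F.L = L → 0 < γ → γ ≤ γ₁ →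
        ∀ (J K : ℕ) (hJK : J ≤ K) (V : GaugeField (F.P J) 0 (Matrix.specialUnitaryGroup (Fin 2) ℂ)),
          ∀ U' ∈ fibre F ℰp J K hJK V, U' ∈ histGood F ℰp (θBal F.L γ b₀ p₀) K J →
            ∀ U ∈ fibre F ℰp J K hJK V, U ∈ histGood F ℰp (θBal F.L γ b₀ p₀) K J →
              ∃ w : Site (F.P K) 0 → Matrix.specialUnitaryGroup (Fin 2) ℂ,
                (∀ U'' : GaugeField (F.P K) 0 (Matrix.specialUnitaryGroup (Fin 2) ℂ),
                    descendTo F ℰp J K hJK (GaugeField.gaugeAct w U'') = descendTo F ℰp J K hJK U'') ∧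
                  ∀ ℓ : PBond (F.P K) 0, dist1 (U ℓ * ((GaugeField.gaugeAct w U') ℓ)⁻¹) ≤ δ :=
  closePair_of_oneStep (oneStep_of_oneStepRooted hR)

end Summit.QuantumFields.YangMills.Theorems.FluctuationComparisonRegPrIntLS2BetaOneStepLift

end
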